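import Mathlib
import Literature.MathematicalPhysics.QuantumFieldTheory.PointwiseOSBoostBlocks
import Literature.Analysis.Complex.PeriodicLocalContinuation
import HarnessLib

/-!
# Block vectors of the pointwise OS boost calculus

Second stage of the analytic continuation of `θ ↦ S(R_θ x)` by the Osterwalder–Schrader calculus of
the time axis `e₀` (`OSBoostChains`, `PointwiseOSBoostCalculus`, `PointwiseOSBoostBlocks`): the
properties of the BLOCK VECTORS `V(ζ) = chainOp … ζ Ω` of a cluster of points seen from a virtual
rotating reference point — holomorphy on the rectangle `|Re ζ - θ₀| < ε, |Im ζ| < R` when the reserved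
time is `u ≤ e^{-R} h'/2` (`block_props`), real symmetry `J V(ζ̄) = V(ζ)`, reproduction of the rotated
relative cluster at real angles, the operator bound, and above all the ANGLE-INDEPENDENT norm bound
`‖V ζ‖² = K(c(Re ζ), c(Re ζ)) ≤ C^{2m+1} (2m)! h'^{-2mΔ}` from rotation invariance of `S_{2m}`
(`inner_self_eq_of_conjOp_eq`, `osPointKernel_block_rot`) and Gaussian domination. `bra_props` is the
mirror-image version (chains of reflected items read at `-ζ`), reduced to `block_props` for the
reflected points (`θ₀ R_φ = R_{-φ} θ₀`).

## References
* J. Glimm, A. Jaffe, *Quantum Physics* (2nd ed. 1987), §19.5–19.7.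
* R. F. Streater, CMP 26 (1972) 109–120.
* K. Osterwalder, R. Schrader, CMP 31 (1973); CMP 42 (1975).
-/

noncomputable section

open Filter ComplexConjugate Complex
open scoped InnerProductSpace Topology
open Literature.Probability.LatticeModels
open Literature.Analysis.OperatorTheory Literature.Analysis.OperatorTheory.KernelVectors
  Literature.Analysis.Complex

namespace Literature.MathematicalPhysics.QuantumFieldTheory

open ChainItem

local notation "E³" => EuclideanSpace ℝ (Fin 3)
local notation "e₀" => EuclideanSpace.single (0 : Fin 3) (1 : ℝ)
local notation "e₁" => EuclideanSpace.single (1 : Fin 3) (1 : ℝ)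
local notation "e₂" => EuclideanSpace.single (2 : Fin 3) (1 : ℝ)

variable {H : Type*} [NormedAddCommGroup H] [InnerProductSpace ℂ H] [CompleteSpace H]

/-! ## Block vectors -/

/-- Heights separate rotated relative points: injectivity and positivity of a block cluster. [folklore] -/
theorem block_cluster_inj_pos {m : ℕ} (ys : Fin m → E³) (q : E³) (θ : ℝ) {h' : ℝ} (hh' : 0 < h')
    (hg0 : ∀ j, h' ≤ planeRot (d := 2) 0 θ (ys j) 0 - planeRot (d := 2) 0 θ q 0)
    (hgs : ∀ i j : Fin m, i < j → h' ≤ planeRot (d := 2) 0 θ (ys j) 0 - planeRot (d := 2) 0 θ (ys i) 0) :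
    Function.Injective (fun j => planeRot (d := 2) 0 θ (ys j - q)) ∧
      ∀ j, 0 < planeRot (d := 2) 0 θ (ys j - q) 0 := by
  refine ⟨fun i j hij => ?_, fun j => ?_⟩
  · by_contra hne
    have key := congrArg (fun z : E³ => z 0) hij
    simp only [map_sub, PiLp.sub_apply] at key
    rcases lt_or_gt_of_ne hne with hlt | hlt
    · have := hgs i j hlt; linarith
    · have := hgs j i hlt; linarith
  · have := hg0 j
    simp only [map_sub, PiLp.sub_apply]
    linarith

/-- Pairwise distances and heights of a block cluster are controlled by the height gaps. [folklore] -/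
theorem block_cluster_sep {m : ℕ} (ys : Fin m → E³) (q : E³) (θ : ℝ) {h' : ℝ} (hh' : 0 < h')
    (hg0 : ∀ j, h' ≤ planeRot (d := 2) 0 θ (ys j) 0 - planeRot (d := 2) 0 θ q 0)
    (hgs : ∀ i j : Fin m, i < j → h' ≤ planeRot (d := 2) 0 θ (ys j) 0 - planeRot (d := 2) 0 θ (ys i) 0) :
    (∀ i j : Fin m, i ≠ j →
        h' ≤ ‖planeRot (d := 2) 0 θ (ys i - q) - planeRot (d := 2) 0 θ (ys j - q)‖) ∧
      ∀ j, h' / 2 ≤ planeRot (d := 2) 0 θ (ys j - q) 0 := by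
  refine ⟨fun i j hij => ?_, fun j => ?_⟩
  · refine le_trans ?_ (abs_apply_le_norm_fin3 _ 0)
    simp only [map_sub, PiLp.sub_apply]
    rcases lt_or_gt_of_ne hij with hlt | hlt
    · have := hgs i j hlt
      rw [abs_sub_comm, abs_of_nonneg (by linarith)]; linarith
    · have := hgs j i hlt
      rw [abs_of_nonneg (by linarith)]; linarith
  · have := hg0 j
    simp only [map_sub, PiLp.sub_apply]
    linarith

/-- **Block vectors of the boost calculus.** For the chain `V(ζ)` of the items of the points
`y₀, …, y_{m-1}` (increasing heights, all gaps and the height above the virtual rotating reference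
`q` at least `h'` on the interval `|θ - θ₀| < ε`) with reservation `u`, `2u ≤ e^{-R} h'`:
holomorphy on the rectangle, real symmetry, reproduction of the rotated relative cluster at real
angles, the ANGLE-INDEPENDENT norm bound from rotation invariance of `S_{m+m}` and Gaussian
domination, and the operator bound of the chain. [cite: GlimmJaffe1987, §19.5–19.7] -/
theorem block_props (S : CorrFamily 3) {Δ Cpd : ℝ} (δ : HalfSpaceConfig 3 0 → H)
    (hδ : DenseRange (Finsupp.linearCombination ℂ δ))
    (hK : ∀ a b, ⟪δ a, δ b⟫_ℂ = (osPointKernel S a b : ℂ))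
    (hPD : ∀ (n : ℕ) (x : Fin n → E³) (r : ℝ), 0 < r → (∀ i j, i ≠ j → r ≤ ‖x i - x j‖) →
      |S n x| ≤ Cpd ^ (n + 1) * (n.factorial : ℝ) * r ^ (-(n : ℝ) * Δ))
    {N : ℂ × ℂ → (H →L[ℂ] H)} {B : ℝ → (H →L[ℂ] H)} {u CB : ℝ} (hu : 0 < u) (hCB : 1 ≤ CB)
    (hNb : ∀ p : ℂ × ℂ, |p.2.im| < p.1.re → ‖N p‖ ≤ 8)
    (hN' : ∀ (U : Set ℂ), IsOpen U → ∀ (q : ℂ → ℂ × ℂ), DifferentiableOn ℂ q U →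
      (∀ z ∈ U, |(q z).2.im| < (q z).1.re) → DifferentiableOn ℂ (fun z => N (q z)) U)
    (hNσ : ∀ t y : ℝ, 0 < t → ∀ b, N ((t : ℂ), (y : ℂ)) (δ b) = δ (b.shift t y))
    (hNc' : ∀ p : ℂ × ℂ, |p.2.im| < p.1.re → ∀ φ : H,
      conjOp δ (N p φ) = N (conj p.1, conj p.2) (conjOp δ φ))
    (hBb : ∀ w, ‖B w‖ ≤ CB) (hBκ : ∀ (w : ℝ) (b : HalfSpaceConfig 3 0), B w (δ b) = δ (b.spinCons hu w))
    (hBc : ∀ (w : ℝ) (φ : H), conjOp δ (B w φ) = B w (conjOp δ φ))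
    {m : ℕ} (hrot : ∀ (φ : ℝ) (z : Fin (m + m) → E³),
      S (m + m) (fun i => planeRot (d := 2) 0 φ (z i)) = S (m + m) z)
    (ys : Fin m → E³) {q : E³} (hq : q 2 = 0) {θ₀ ε R h' : ℝ} (hh' : 0 < h') (hR : 0 < R)
    (huR : 2 * u ≤ Real.exp (-R) * h')
    (hg0 : ∀ θ : ℝ, |θ - θ₀| < ε → ∀ j, h' ≤ planeRot (d := 2) 0 θ (ys j) 0 - planeRot (d := 2) 0 θ q 0)
    (hgs : ∀ θ : ℝ, |θ - θ₀| < ε → ∀ i j : Fin m, i < j →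
      h' ≤ planeRot (d := 2) 0 θ (ys j) 0 - planeRot (d := 2) 0 θ (ys i) 0)
    {V : ℂ → H} (hV : V = fun ζ => chainOp N B u (List.ofFn fun j => itemOf (ys j)) (virtOf q) ζ
      (δ (HalfSpaceConfig.empty 3 0))) :
    DifferentiableOn ℂ V {ζ : ℂ | |ζ.re - θ₀| < ε ∧ |ζ.im| < R} ∧
    (∀ ζ : ℂ, |ζ.re - θ₀| < ε → |ζ.im| < R → conjOp δ (V (conj ζ)) = V ζ) ∧
    (∀ θ : ℝ, |θ - θ₀| < ε → ∃ hinj hpos,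
      V θ = δ ⟨m, fun j => planeRot (d := 2) 0 θ (ys j - q), hinj, hpos⟩) ∧
    (∀ ζ : ℂ, |ζ.re - θ₀| < ε → |ζ.im| < R →
      ‖V ζ‖ ^ 2 ≤ Cpd ^ (m + m + 1) * ((m + m).factorial : ℝ) * h' ^ (-((m + m : ℕ) : ℝ) * Δ)) ∧
    (∀ ζ : ℂ, |ζ.re - θ₀| < ε → |ζ.im| < R → ∀ φ : H,
      ‖chainOp N B u (List.ofFn fun j => itemOf (ys j)) (virtOf q) ζ φ‖ ≤ (8 * CB) ^ m * ‖φ‖) ∧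
    (∀ θ : ℝ, |θ - θ₀| < ε → List.IsChain (fun Q P => res u Q + res u P < P.t θ - Q.t θ)
      (virtOf q :: List.ofFn fun j => itemOf (ys j)) ∧
      V θ = δ (chainCfg (fun t y b => b.shift t y) (fun w b => b.spinCons hu w) u
        (List.ofFn fun j => itemOf (ys j)) (virtOf q) θ (HalfSpaceConfig.empty 3 0))) := by
  have hreal : ∀ a b, (⟪δ a, δ b⟫_ℂ).im = 0 := im_inner_gen_eq_zero hK
  set D : Set ℂ := {ζ : ℂ | |ζ.re - θ₀| < ε ∧ |ζ.im| < R} with hD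
  set L : List ChainItem := List.ofFn fun j => itemOf (ys j) with hL
  have hu2 : 2 * u < h' := by
    have : Real.exp (-R) < 1 := Real.exp_lt_one_iff.2 (by linarith)
    nlinarith
  -- the cone conditions on the rectangle
  have hchainD : List.IsChain (fun Q P => ∀ z ∈ D, |(gap u Q P z).2.im| < (gap u Q P z).1.re) (virtOf q :: L) := by
    refine isChain_cons_ofFn (virtOf q) (fun j => itemOf (ys j)) (fun hm z hz => ?_) (fun i hi z hz => ?_)
    · refine gap_mem_tube hu.le hh' huR ?_ hz.2
      rw [itemOf_t, virtOf_t]; exact hg0 z.re hz.1 _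
    · refine gap_mem_tube hu.le hh' huR ?_ hz.2
      rw [itemOf_t, itemOf_t]; exact hgs z.re hz.1 _ _ (by simp)
  have hchainAt : ∀ ζ ∈ D, List.IsChain (fun Q P => |(gap u Q P ζ).2.im| < (gap u Q P ζ).1.re) (virtOf q :: L) :=
    fun ζ hζ => hchainD.imp fun Q P h => h ζ hζ
  -- the real reserved gaps are positive
  have hchainR : ∀ θ : ℝ, |θ - θ₀| < ε →
      List.IsChain (fun Q P => res u Q + res u P < P.t θ - Q.t θ) (virtOf q :: L) := by
    intro θ hθ
    refine isChain_cons_ofFn (virtOf q) (fun j => itemOf (ys j)) (fun hm => ?_) (fun i hi => ?_)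
    · rw [res_virtOf, res_itemOf, itemOf_t, virtOf_t]
      have := hg0 θ hθ ⟨0, hm⟩; linarith
    · rw [res_itemOf, res_itemOf, itemOf_t, itemOf_t]
      have := hgs θ hθ ⟨i, by omega⟩ ⟨i + 1, hi⟩ (by simp); linarith
  -- (1) holomorphy
  have h1 : DifferentiableOn ℂ V D := by
    rw [hV]
    exact (differentiableOn_chainOp hN' (isOpen_rect θ₀ ε R) L (virtOf q) hchainD).clm_apply
      (differentiableOn_const _)
  -- (2) real symmetry
  have h2 : ∀ ζ : ℂ, |ζ.re - θ₀| < ε → |ζ.im| < R → conjOp δ (V (conj ζ)) = V ζ := by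
    intro ζ hζ hζ'
    rw [hV]
    dsimp only
    rw [conjOp_chainOp_apply δ hNc' hBc L (virtOf q) ζ (hchainAt ζ ⟨hζ, hζ'⟩), conjOp_gen δ hδ hreal]
  -- (3) real values
  have h3 : ∀ θ : ℝ, |θ - θ₀| < ε → ∃ hinj hpos,
      V θ = δ ⟨m, fun j => planeRot (d := 2) 0 θ (ys j - q), hinj, hpos⟩ := by
    intro θ hθ
    obtain ⟨hinj, hpos⟩ := block_cluster_inj_pos ys q θ hh' (hg0 θ hθ) (hgs θ hθ)
    refine ⟨hinj, hpos, ?_⟩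
    rw [hV]
    dsimp only
    rw [chainOp_apply_gen δ (fun t y b => b.shift t y) (fun w b => b.spinCons hu w) hNσ hBκ L (virtOf q) θ
      (hchainR θ hθ), hL, chainCfg_ofFn_eq hu θ ys hq (hchainR θ hθ) hinj hpos]
  -- the cluster as a function of the angle
  classical
  set c : ℝ → HalfSpaceConfig 3 0 := fun θ =>
    if hθ : |θ - θ₀| < ε then
      ⟨m, fun j => planeRot (d := 2) 0 θ (ys j - q),
        (block_cluster_inj_pos ys q θ hh' (hg0 θ hθ) (hgs θ hθ)).1,
        (block_cluster_inj_pos ys q θ hh' (hg0 θ hθ) (hgs θ hθ)).2⟩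
    else HalfSpaceConfig.empty 3 0 with hc
  have hcθ : ∀ θ : ℝ, |θ - θ₀| < ε → ∃ hinj hpos,
      c θ = ⟨m, fun j => planeRot (d := 2) 0 θ (ys j - q), hinj, hpos⟩ := by
    intro θ hθ
    exact ⟨_, _, dif_pos hθ⟩
  have hVc : ∀ θ : ℝ, |θ - θ₀| < ε → V θ = δ (c θ) := by
    intro θ hθ
    obtain ⟨_, _, e⟩ := h3 θ hθ
    rw [e, hc]
    dsimp only
    rw [dif_pos hθ]
  -- (4) the norm identity and the a priori bound
  have h4 : ∀ ζ : ℂ, |ζ.re - θ₀| < ε → |ζ.im| < R →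
      ‖V ζ‖ ^ 2 ≤ Cpd ^ (m + m + 1) * ((m + m).factorial : ℝ) * h' ^ (-((m + m : ℕ) : ℝ) * Δ) := by
    intro ζ hζ hζ'
    have hKrig : ∀ θ s : ℝ, |θ - s - θ₀| < ε → |θ + s - θ₀| < ε →
        ⟪δ (c (θ - s)), δ (c (θ + s))⟫_ℂ = ⟪δ (c θ), δ (c θ)⟫_ℂ := by
      intro θ s h₁ h₂
      have hθ : |θ - θ₀| < ε := by
        rw [abs_lt] at h₁ h₂ ⊢; constructor <;> linarith
      rw [hK, hK]
      congr 1
      refine osPointKernel_block_rot S hrot (fun j => ys j - q) θ s (hcθ _ h₁) (hcθ _ h₂) (hcθ _ hθ)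
    have key := inner_self_eq_of_conjOp_eq δ hδ hreal h1 h2 c hVc hKrig hζ hζ'
    have hre : ‖V ζ‖ ^ 2 = osPointKernel S (c ζ.re) (c ζ.re) := by
      rw [@norm_sq_eq_re_inner ℂ, key, hK]; simp
    rw [hre]
    refine (le_abs_self _).trans ?_
    obtain ⟨hinj, hpos, e⟩ := hcθ ζ.re hζ
    obtain ⟨hsep, hht⟩ := block_cluster_sep ys q ζ.re hh' (hg0 ζ.re hζ) (hgs ζ.re hζ)
    have := abs_osPointKernel_self_le S hPD (c ζ.re) hh' (by rw [e]; exact hsep) (by rw [e]; exact hht)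
    rw [e] at this ⊢
    exact this
  -- (5) the operator bound
  have h5 : ∀ ζ : ℂ, |ζ.re - θ₀| < ε → |ζ.im| < R → ∀ φ : H,
      ‖chainOp N B u L (virtOf q) ζ φ‖ ≤ (8 * CB) ^ m * ‖φ‖ := by
    intro ζ hζ hζ' φ
    have := norm_chainOp_apply_le (by norm_num : (0:ℝ) ≤ 8) hCB hNb hBb L (virtOf q) ζ (hchainAt ζ ⟨hζ, hζ'⟩) φ
    rwa [hL, List.length_ofFn] at this
  have h6 : ∀ θ : ℝ, |θ - θ₀| < ε → List.IsChain (fun Q P => res u Q + res u P < P.t θ - Q.t θ)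
      (virtOf q :: L) ∧ V θ = δ (chainCfg (fun t y b => b.shift t y) (fun w b => b.spinCons hu w) u
        L (virtOf q) θ (HalfSpaceConfig.empty 3 0)) := by
    intro θ hθ
    refine ⟨hchainR θ hθ, ?_⟩
    rw [hV]
    dsimp only
    rw [chainOp_apply_gen δ (fun t y b => b.shift t y) (fun w b => b.spinCons hu w) hNσ hBκ L (virtOf q) θ
      (hchainR θ hθ)]
  exact ⟨h1, h2, h3, h4, h5, h6⟩

/-- **Mirror-image block vectors** (the bra side): the chain of the reflected items of points
`y₀, …, y_{m-1}` BELOW the reference `q` (decreasing heights), read at the angle `-ζ`, equals the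
block vector of the reflected points seen from the reflected reference; hence holomorphy, real
symmetry, reproduction of the mirror image `{θ₀ R_θ (y_j - q)}`, and the angle-independent norm
bound. [cite: GlimmJaffe1987, §19.5–19.7] -/
theorem bra_props (S : CorrFamily 3) {Δ Cpd : ℝ} (δ : HalfSpaceConfig 3 0 → H)
    (hδ : DenseRange (Finsupp.linearCombination ℂ δ))
    (hK : ∀ a b, ⟪δ a, δ b⟫_ℂ = (osPointKernel S a b : ℂ))
    (hPD : ∀ (n : ℕ) (x : Fin n → E³) (r : ℝ), 0 < r → (∀ i j, i ≠ j → r ≤ ‖x i - x j‖) →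
      |S n x| ≤ Cpd ^ (n + 1) * (n.factorial : ℝ) * r ^ (-(n : ℝ) * Δ))
    {N : ℂ × ℂ → (H →L[ℂ] H)} {B : ℝ → (H →L[ℂ] H)} {u CB : ℝ} (hu : 0 < u) (hCB : 1 ≤ CB)
    (hNb : ∀ p : ℂ × ℂ, |p.2.im| < p.1.re → ‖N p‖ ≤ 8)
    (hN' : ∀ (U : Set ℂ), IsOpen U → ∀ (q : ℂ → ℂ × ℂ), DifferentiableOn ℂ q U →
      (∀ z ∈ U, |(q z).2.im| < (q z).1.re) → DifferentiableOn ℂ (fun z => N (q z)) U)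
    (hNσ : ∀ t y : ℝ, 0 < t → ∀ b, N ((t : ℂ), (y : ℂ)) (δ b) = δ (b.shift t y))
    (hNc' : ∀ p : ℂ × ℂ, |p.2.im| < p.1.re → ∀ φ : H,
      conjOp δ (N p φ) = N (conj p.1, conj p.2) (conjOp δ φ))
    (hBb : ∀ w, ‖B w‖ ≤ CB) (hBκ : ∀ (w : ℝ) (b : HalfSpaceConfig 3 0), B w (δ b) = δ (b.spinCons hu w))
    (hBc : ∀ (w : ℝ) (φ : H), conjOp δ (B w φ) = B w (conjOp δ φ))
    {m : ℕ} (hrot : ∀ (φ : ℝ) (z : Fin (m + m) → E³),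
      S (m + m) (fun i => planeRot (d := 2) 0 φ (z i)) = S (m + m) z)
    (ys : Fin m → E³) {q : E³} (hq : q 2 = 0) {θ₀ ε R h' : ℝ} (hh' : 0 < h') (hR : 0 < R)
    (huR : 2 * u ≤ Real.exp (-R) * h')
    (hg0 : ∀ θ : ℝ, |θ - θ₀| < ε → ∀ j, h' ≤ planeRot (d := 2) 0 θ q 0 - planeRot (d := 2) 0 θ (ys j) 0)
    (hgs : ∀ θ : ℝ, |θ - θ₀| < ε → ∀ i j : Fin m, i < j →
      h' ≤ planeRot (d := 2) 0 θ (ys i) 0 - planeRot (d := 2) 0 θ (ys j) 0)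
    {W : ℂ → H} (hW : W = fun ζ => chainOp N B u (List.ofFn fun j => (itemOf (ys j)).refl) (virtOf q).refl (-ζ)
      (δ (HalfSpaceConfig.empty 3 0))) :
    DifferentiableOn ℂ W {ζ : ℂ | |ζ.re - θ₀| < ε ∧ |ζ.im| < R} ∧
    (∀ ζ : ℂ, |ζ.re - θ₀| < ε → |ζ.im| < R → conjOp δ (W (conj ζ)) = W ζ) ∧
    (∀ θ : ℝ, |θ - θ₀| < ε → ∃ hinj hpos,
      W θ = δ ⟨m, fun j => axisReflection 0 (planeRot (d := 2) 0 θ (ys j - q)), hinj, hpos⟩) ∧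
    (∀ ζ : ℂ, |ζ.re - θ₀| < ε → |ζ.im| < R →
      ‖W ζ‖ ^ 2 ≤ Cpd ^ (m + m + 1) * ((m + m).factorial : ℝ) * h' ^ (-((m + m : ℕ) : ℝ) * Δ)) := by
  -- the reflected data
  set ys' : Fin m → E³ := fun j => axisReflection 0 (ys j) with hys'
  set q' : E³ := axisReflection 0 q with hq'def
  have hq' : q' 2 = 0 := by simp [hq'def, hq]
  have hT : ∀ (θ : ℝ) (y : E³), planeRot (d := 2) 0 θ (axisReflection 0 y) 0 = -(planeRot (d := 2) 0 (-θ) y 0) := by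
    intro θ y
    have := axisReflection_planeRot (-θ) y
    rw [neg_neg] at this
    rw [← this]
    simp
  have hg0' : ∀ θ : ℝ, |θ - (-θ₀)| < ε → ∀ j, h' ≤ planeRot (d := 2) 0 θ (ys' j) 0 - planeRot (d := 2) 0 θ q' 0 := by
    intro θ hθ j
    have h := hg0 (-θ) (by rw [show -θ - θ₀ = -(θ - -θ₀) by ring, abs_neg]; exact hθ) j
    simp only [hys', hq'def, hT]
    linarith
  have hgs' : ∀ θ : ℝ, |θ - (-θ₀)| < ε → ∀ i j : Fin m, i < j →
      h' ≤ planeRot (d := 2) 0 θ (ys' j) 0 - planeRot (d := 2) 0 θ (ys' i) 0 := by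
    intro θ hθ i j hij
    have h := hgs (-θ) (by rw [show -θ - θ₀ = -(θ - -θ₀) by ring, abs_neg]; exact hθ) i j hij
    simp only [hys', hT]
    linarith
  set V : ℂ → H := fun ζ => chainOp N B u (List.ofFn fun j => itemOf (ys' j)) (virtOf q') ζ
    (δ (HalfSpaceConfig.empty 3 0)) with hV
  obtain ⟨h1, h2, h3, h4, -, -⟩ := block_props S δ hδ hK hPD hu hCB hNb hN' hNσ hNc' hBb hBκ hBc hrot ys' hq'
    hh' hR huR hg0' hgs' hV
  have hWV : W = fun ζ => V (-ζ) := by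
    rw [hW, hV]
    funext ζ
    simp only [itemOf_refl, virtOf_refl, hys', hq'def]
  have hmaps : ∀ ζ : ℂ, |ζ.re - θ₀| < ε → |ζ.im| < R → |(-ζ).re - (-θ₀)| < ε ∧ |(-ζ).im| < R := by
    intro ζ h₁ h₂
    constructor
    · rw [show (-ζ).re - -θ₀ = -(ζ.re - θ₀) by simp; ring, abs_neg]; exact h₁
    · simpa using h₂
  refine ⟨?_, fun ζ hζ hζ' => ?_, fun θ hθ => ?_, fun ζ hζ hζ' => ?_⟩
  · rw [hWV]
    exact h1.comp (differentiableOn_neg _) fun ζ hζ => hmaps ζ hζ.1 hζ.2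
  · rw [hWV]
    dsimp only
    obtain ⟨hm1, hm2⟩ := hmaps ζ hζ hζ'
    have := h2 (-ζ) hm1 hm2
    rwa [show conj (-ζ) = -conj ζ from map_neg _ _] at this
  · obtain ⟨hm1, -⟩ := hmaps θ hθ (by simpa using hR)
    simp only [Complex.neg_re, Complex.ofReal_re] at hm1
    obtain ⟨hinj', hpos', e⟩ := h3 (-θ) hm1
    have hfg : (fun j => planeRot (d := 2) 0 (-θ) (ys' j - q')) =
        fun j => axisReflection 0 (planeRot (d := 2) 0 θ (ys j - q)) := by
      funext j
      simp only [hys', hq'def, ← map_sub, axisReflection_planeRot]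
    have hinj : Function.Injective fun j => axisReflection 0 (planeRot (d := 2) 0 θ (ys j - q)) := hfg ▸ hinj'
    have hpos : ∀ j, 0 < axisReflection 0 (planeRot (d := 2) 0 θ (ys j - q)) 0 := fun j => by
      have := hpos' j
      rwa [congrFun hfg j] at this
    refine ⟨hinj, hpos, ?_⟩
    rw [hWV]
    dsimp only
    rw [show -(θ : ℂ) = ((-θ : ℝ) : ℂ) by push_cast; ring, e]
    congr 1
    exact HalfSpaceConfig.ext' (Sigma.ext rfl (heq_of_eq hfg))
  · rw [hWV]
    obtain ⟨hm1, hm2⟩ := hmaps ζ hζ hζ'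
    exact h4 (-ζ) hm1 hm2

end Literature.MathematicalPhysics.QuantumFieldTheory
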